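import Summits.ResolutionOfSingularities.ResolutionOfSingularities.Theorems.FrobeniusLadderFInjectiveMacaulayficationLx6c3Specimen
import Summits.ResolutionOfSingularities.ResolutionOfSingularities.Theorems.FrobeniusLadderFInjectiveMacaulayficationPrimeTransfer
import HarnessLib

/-!
# (W-TD) BED D (D-0) = `z⁴ + x⁵z + x⁶ + y³ + u³ + t⁷` (char 2, `d = 4`): the specimen package — prime, no variable vanishes, vertex closed / singular / isolated / dim 4 / CM, NOT FULL
# (crux `FInjectiveMacaulayfication` stmt-ResolutionOfSingularities-15315, chain w45a; res-L1-w45a-plan-1 RULING R21.15 (2) «PROGRAMME (W-TD) ON BED D, (D-0) INPUT SIDE — stub-3»;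
# BED D = this seat's automorphism-stable candidate (STATUS l.≈82718, evidence l.≈82790), re-derived and PLANE-RIGID by res-L1-w45a-tri-2 g17 (memo `Q13-fD-tri2.md`: one Tjurina-bad
# face F₀ = {z⁴, x⁶} of 31, In = (z²+x³)², section semigroup ⟨4,6,13⟩ ⇒ weakly non-degenerate in NO plane coordinates); seat res-L1-w45a-stub-3 g11; twin of `P3d4z4557Specimen`)

[OURS · L1 W4.5a] Support file (`--supports stmt-ResolutionOfSingularities-15315 --as helper`); def-free, unconditional; replaces the role of NO printed item; NOT a statement
of the manuscript; AI-written (AI review is weaker than expert review).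

`X 0 = x`, `X 1 = y`, `X 2 = u`, `X 3 = t`, `X 4 = z`; `f = z⁴ + x⁵z + x⁶ + y³ + u³ + t⁷`; `v` = the origin of `X = Spec k[X]/(f)`, `char k = 2` (ANY field of characteristic 2).
* §1 `casts_char2`, `pderiv_zero_f` (`∂_x f = x⁴z`), `pderiv_cube_f` (`∂_y f = y²`, `∂_u f = u²`), `pderiv_three_f` (`∂_t f = t⁶`), `pderiv_four_f` (`∂_z f = x⁵`), `constantCoeff_f`,
  `prime_swapped` + ★ `prime_f` (swap `y ↔ z`, then Eisenstein-type in `T = z`: `T³ + C(c)`, `c = y⁴+x⁵y+x⁶+u³+t⁷` vanishes at `(x,y,u,t) = (0,0,1,1)` where `∂_u c = u² = 1`), `regular_off_vertex` (Jacobian off `𝔪`: `x⁵, y², u², t⁶`;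
  `z` alone cannot miss a prime containing `x,y,u,t`: `z⁴ = f − …`) = the class rows' `hreg`, `isPrime_span_f`, `f_not_mem_span_X`, ★ `mk_X_ne_zero` (= `hXne`), `isIntegral_fD`;
* §2 (H1)–(H5) at `v`: `isClosed_vertex`, `vertex_not_mem_regularLocus`, `ringKrullDim_stalk_vertex = 4`, `regular_of_ne_vertex`, `regular_off_closedPoint_vertex`, `cmCl_Spec_stalk_vertex`;
* §3 `f_mem_bracket` (`f ∈ 𝔪^{[2]}` termwise), ★ `fD_vertex_not_fullCl : ¬ FullCl 2 𝒪_{X,v}` (Fedder necessity).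
[folklore mathematics, OURS as a certificate; cite: Hartshorne1977, I Thm. 5.1; Matsumura1987, Thm. 17.4; Fedder1983, Prop. 1.7]
-/

-- single-problem summit: the doubled namespace component is forced
set_option linter.dupNamespace false

noncomputable section

open AlgebraicGeometry CategoryTheory Literature.AlgebraicGeometry.Resolution TopologicalSpace IsLocalRing MvPolynomial

namespace Summit.ResolutionOfSingularities.ResolutionOfSingularities.Theorems.FInjectiveMacaulayfication.FDSpecimen

open Summit.ResolutionOfSingularities.ResolutionOfSingularities.Theorems.FInjectiveMacaulayfication
open SliceableCentre GermForm GermOfGlobalBlowup FCentreE1RungZero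

/-! ## §1 Derivatives, primality, regularity off the vertex -/

/-- In characteristic `2`: `3 = 1`, `4 = 0`, `5 = 1`, `6 = 0`, `7 = 1` in `k[X]`. [folklore] -/
theorem casts_char2 (k : Type) [Field k] [CharP k 2] :
    (3 : MvPolynomial (Fin 5) k) = 1 ∧ (4 : MvPolynomial (Fin 5) k) = 0 ∧ (5 : MvPolynomial (Fin 5) k) = 1 ∧ (6 : MvPolynomial (Fin 5) k) = 0 ∧
      (7 : MvPolynomial (Fin 5) k) = 1 := by
  have h2 : (2 : MvPolynomial (Fin 5) k) = 0 := (FermatCubicConeChar2.two_three k (n := 5)).1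
  refine ⟨?_, ?_, ?_, ?_, ?_⟩
  · calc (3 : MvPolynomial (Fin 5) k) = 2 + 1 := by norm_num
      _ = 1 := by rw [h2]; ring
  · calc (4 : MvPolynomial (Fin 5) k) = 2 * 2 := by norm_num
      _ = 0 := by rw [h2]; ring
  · calc (5 : MvPolynomial (Fin 5) k) = 2 * 2 + 1 := by norm_num
      _ = 1 := by rw [h2]; ring
  · calc (6 : MvPolynomial (Fin 5) k) = 2 * 3 := by norm_num
      _ = 0 := by rw [h2]; ring
  · calc (7 : MvPolynomial (Fin 5) k) = 2 * 3 + 1 := by norm_num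
      _ = 1 := by rw [h2]; ring

/-- `∂f/∂x = 5x⁴z + 6x⁵ = x⁴z` in characteristic 2. [folklore] -/
theorem pderiv_zero_f (k : Type) [Field k] [CharP k 2] (f : MvPolynomial (Fin 5) k)
    (hf : f = X 4 ^ 4 + X 0 ^ 5 * X 4 + X 0 ^ 6 + X 1 ^ 3 + X 2 ^ 3 + X 3 ^ 7) : pderiv 0 f = X 0 ^ 4 * X 4 := by
  obtain ⟨-, -, h5, h6, -⟩ := casts_char2 k
  rw [hf]
  simp only [map_add, Derivation.leibniz, pderiv_pow, pderiv_X_self, pderiv_X_of_ne (show (4 : Fin 5) ≠ 0 by decide),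
    pderiv_X_of_ne (show (1 : Fin 5) ≠ 0 by decide), pderiv_X_of_ne (show (2 : Fin 5) ≠ 0 by decide),
    pderiv_X_of_ne (show (3 : Fin 5) ≠ 0 by decide), smul_eq_mul, mul_zero, mul_one, add_zero, zero_add]
  push_cast
  rw [h5, h6]
  ring

/-- `∂f/∂y = 3y² = y²`, `∂f/∂u = 3u² = u²` in characteristic 2. [folklore] -/
theorem pderiv_cube_f (k : Type) [Field k] [CharP k 2] (f : MvPolynomial (Fin 5) k)
    (hf : f = X 4 ^ 4 + X 0 ^ 5 * X 4 + X 0 ^ 6 + X 1 ^ 3 + X 2 ^ 3 + X 3 ^ 7) (j : Fin 5) (hj : j = 1 ∨ j = 2) :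
    pderiv j f = X j ^ 2 := by
  obtain ⟨h3, -, -, -, -⟩ := casts_char2 k
  rw [hf]
  rcases hj with rfl | rfl
  all_goals
    simp only [map_add, Derivation.leibniz, pderiv_pow, pderiv_X_self, smul_eq_mul, pderiv_X_of_ne (show (4 : Fin 5) ≠ 1 by decide),
      pderiv_X_of_ne (show (0 : Fin 5) ≠ 1 by decide), pderiv_X_of_ne (show (2 : Fin 5) ≠ 1 by decide),
      pderiv_X_of_ne (show (3 : Fin 5) ≠ 1 by decide), pderiv_X_of_ne (show (4 : Fin 5) ≠ 2 by decide),
      pderiv_X_of_ne (show (0 : Fin 5) ≠ 2 by decide), pderiv_X_of_ne (show (1 : Fin 5) ≠ 2 by decide),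
      pderiv_X_of_ne (show (3 : Fin 5) ≠ 2 by decide), mul_zero, mul_one, zero_add, add_zero]
    push_cast
    rw [h3]
    ring

/-- `∂f/∂t = 7t⁶ = t⁶` in characteristic 2. [folklore] -/
theorem pderiv_three_f (k : Type) [Field k] [CharP k 2] (f : MvPolynomial (Fin 5) k)
    (hf : f = X 4 ^ 4 + X 0 ^ 5 * X 4 + X 0 ^ 6 + X 1 ^ 3 + X 2 ^ 3 + X 3 ^ 7) : pderiv 3 f = X 3 ^ 6 := by
  obtain ⟨-, -, -, -, h7⟩ := casts_char2 k
  rw [hf]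
  simp only [map_add, Derivation.leibniz, pderiv_pow, pderiv_X_self, smul_eq_mul, pderiv_X_of_ne (show (4 : Fin 5) ≠ 3 by decide),
    pderiv_X_of_ne (show (0 : Fin 5) ≠ 3 by decide), pderiv_X_of_ne (show (1 : Fin 5) ≠ 3 by decide),
    pderiv_X_of_ne (show (2 : Fin 5) ≠ 3 by decide), mul_zero, mul_one, zero_add, add_zero]
  push_cast
  rw [h7]
  ring

/-- `∂f/∂z = 4z³ + x⁵ = x⁵` in characteristic 2. [folklore] -/
theorem pderiv_four_f (k : Type) [Field k] [CharP k 2] (f : MvPolynomial (Fin 5) k)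
    (hf : f = X 4 ^ 4 + X 0 ^ 5 * X 4 + X 0 ^ 6 + X 1 ^ 3 + X 2 ^ 3 + X 3 ^ 7) : pderiv 4 f = X 0 ^ 5 := by
  obtain ⟨-, h4, -, -, -⟩ := casts_char2 k
  rw [hf]
  simp only [map_add, Derivation.leibniz, pderiv_pow, pderiv_X_self, smul_eq_mul, pderiv_X_of_ne (show (0 : Fin 5) ≠ 4 by decide),
    pderiv_X_of_ne (show (1 : Fin 5) ≠ 4 by decide), pderiv_X_of_ne (show (2 : Fin 5) ≠ 4 by decide),
    pderiv_X_of_ne (show (3 : Fin 5) ≠ 4 by decide), mul_zero, mul_one, add_zero]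
  push_cast
  rw [h4]
  ring

/-- `f` has no constant term. [folklore] -/
theorem constantCoeff_f (k : Type) [Field k] (f : MvPolynomial (Fin 5) k)
    (hf : f = X 4 ^ 4 + X 0 ^ 5 * X 4 + X 0 ^ 6 + X 1 ^ 3 + X 2 ^ 3 + X 3 ^ 7) : constantCoeff f = 0 := by
  rw [hf]
  simp [constantCoeff_X]

/-- Primality of the variable-swapped polynomial `y⁴ + x⁵y + x⁶ + z³ + u³ + t⁷` (`X 1 ↔ X 4`): as `T³ + C(0)·T + C(c)` in `T = X 4` over `k[X 0..X 3]`,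
`c = X1⁴ + X0⁵X1 + X0⁶ + X2³ + X3⁷`, Eisenstein-type at `(0,0,1,1)` where `c = 1 + 1 = 0` and `∂_{X2} c = 3X2² = 1 ≠ 0`. [folklore] -/
theorem prime_swapped (k : Type) [Field k] [CharP k 2] (g : MvPolynomial (Fin 5) k)
    (hg : g = X 1 ^ 4 + X 0 ^ 5 * X 1 + X 0 ^ 6 + X 4 ^ 3 + X 2 ^ 3 + X 3 ^ 7) : Prime g := by
  set e : MvPolynomial (Fin 5) k ≃+* Polynomial (MvPolynomial (Fin 4) k) :=
    ((renameEquiv k (_root_.finRotate 5)).trans (finSuccEquiv k 4)).toRingEquiv with he_def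
  have hrot4 : (_root_.finRotate 5) (4 : Fin 5) = 0 := by decide
  have hrot : ∀ j : Fin 4, (_root_.finRotate 5) (Fin.castSucc j) = j.succ := by decide
  have he4 : e (X 4) = Polynomial.X := by
    show finSuccEquiv k 4 (rename _ (X 4)) = _
    rw [rename_X, hrot4]; exact finSuccEquiv_X_zero
  have hej : ∀ j : Fin 4, e (X (Fin.castSucc j)) = Polynomial.C (X j) := fun j => by
    show finSuccEquiv k 4 (rename _ (X (Fin.castSucc j))) = _
    rw [rename_X, hrot j]; exact finSuccEquiv_X_succ (j := j)
  set b : MvPolynomial (Fin 4) k := 0 with hb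
  set c : MvPolynomial (Fin 4) k := X 1 ^ 4 + X 0 ^ 5 * X 1 + X 0 ^ 6 + X 2 ^ 3 + X 3 ^ 7 with hc
  have hef : e g = Polynomial.X ^ 3 + Polynomial.C b * Polynomial.X + Polynomial.C c := by
    rw [hg, map_add, map_add, map_add, map_add, map_add, map_pow, map_mul, map_pow, map_pow, map_pow, he4, map_pow, map_pow,
      show (0 : Fin 5) = Fin.castSucc (0 : Fin 4) from rfl, show (1 : Fin 5) = Fin.castSucc (1 : Fin 4) from rfl,
      show (2 : Fin 5) = Fin.castSucc (2 : Fin 4) from rfl, show (3 : Fin 5) = Fin.castSucc (3 : Fin 4) from rfl, hej, hej, hej, hej, hb, hc]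
    simp only [map_add, map_pow, map_mul, map_zero, zero_mul, add_zero]
    ring
  set a : Fin 4 → k := ![0, 0, 1, 1] with ha
  have h2 : (2 : k) = 0 := by simpa using CharP.cast_eq_zero k 2
  have h3 : (3 : k) = 1 := by
    calc (3 : k) = 2 + 1 := by norm_num
      _ = 1 := by rw [h2]; ring
  have hba : MvPolynomial.eval a b = 0 := by rw [hb, map_zero]
  have hca : MvPolynomial.eval a c = 0 := by
    rw [hc]
    simp only [map_add, map_pow, map_mul, eval_X, ha, Matrix.cons_val_zero, Matrix.cons_val_one]
    simp only [Matrix.cons_val, one_pow, zero_pow (by norm_num : (4 : ℕ) ≠ 0), zero_pow (by norm_num : (5 : ℕ) ≠ 0), zero_pow (by norm_num : (6 : ℕ) ≠ 0),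
      zero_mul, add_zero, zero_add]
    rw [show (1 : k) + 1 = 2 by norm_num, h2]
  have hder : MvPolynomial.eval a (pderiv 2 c) ≠ 0 := by
    have e1 : pderiv 2 c = 3 * X 2 ^ 2 := by
      rw [hc]
      simp only [map_add, Derivation.leibniz, pderiv_pow, pderiv_X_self, smul_eq_mul, pderiv_X_of_ne (show (1 : Fin 4) ≠ 2 by decide),
        pderiv_X_of_ne (show (0 : Fin 4) ≠ 2 by decide), pderiv_X_of_ne (show (3 : Fin 4) ≠ 2 by decide), mul_zero, zero_add, add_zero, mul_one]
      push_cast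
      ring
    rw [e1, map_mul, map_pow, eval_X, ha]
    simp only [Matrix.cons_val]
    rw [map_ofNat, h3]
    simp
  have hirr : Irreducible (e g) := by
    rw [hef]
    exact Literature.AlgebraicGeometry.Motives.SmoothHypersurface.irreducible_X_pow_add_C_mul_X_add_C (d := 3) (by norm_num) b c a hba hca 2 hder
  exact (MulEquiv.prime_iff e).mp hirr.prime

/-- **`f` is PRIME** (any field of characteristic 2): swap the variables `y ↔ z` (a ring automorphism of `k[X]`) and apply `prime_swapped`. [folklore] -/
theorem prime_f (k : Type) [Field k] [CharP k 2] (f : MvPolynomial (Fin 5) k)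
    (hf : f = X 4 ^ 4 + X 0 ^ 5 * X 4 + X 0 ^ 6 + X 1 ^ 3 + X 2 ^ 3 + X 3 ^ 7) : Prime f := by
  set s : MvPolynomial (Fin 5) k ≃+* MvPolynomial (Fin 5) k := (renameEquiv k (Equiv.swap (1 : Fin 5) 4)).toRingEquiv with hs
  have hsX : ∀ j : Fin 5, s (X j) = X (Equiv.swap (1 : Fin 5) 4 j) := fun j => by
    show rename _ (X j) = _
    rw [rename_X]
  have hsf : s f = X 1 ^ 4 + X 0 ^ 5 * X 1 + X 0 ^ 6 + X 4 ^ 3 + X 2 ^ 3 + X 3 ^ 7 := by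
    rw [hf]
    simp only [map_add, map_mul, map_pow, hsX]
    simp [Equiv.swap_apply_def]
  exact (MulEquiv.prime_iff s).mp (prime_swapped k (s f) hsf)

/-- **`(k[X]/(f))_P` is regular at every prime `P ⊉ (x̄, ȳ, ū, t̄, z̄)`**: some variable other than `z` misses `P` (`z⁴ = f − x⁵z − x⁶ − y³ − u³ − t⁷`), and then the partial
`x⁵` (`∂_z`), `y²`, `u²` or `t⁶` misses `P` (Jacobian criterion). [cite: Hartshorne1977, I Thm. 5.1] -/
theorem regular_off_vertex (k : Type) [Field k] [CharP k 2] (f : MvPolynomial (Fin 5) k)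
    (hf : f = X 4 ^ 4 + X 0 ^ 5 * X 4 + X 0 ^ 6 + X 1 ^ 3 + X 2 ^ 3 + X 3 ^ 7)
    (P : Ideal (MvPolynomial (Fin 5) k ⧸ Ideal.span {f})) [P.IsPrime]
    (hP : ¬ Ideal.span (Set.range fun j : Fin 5 => Ideal.Quotient.mk (Ideal.span {f}) (X j)) ≤ P) :
    IsRegularLocalRing (Localization.AtPrime P) := by
  have hP' : (P.comap (Ideal.Quotient.mk (Ideal.span {f}))).IsPrime := Ideal.comap_isPrime _ _
  set P' := P.comap (Ideal.Quotient.mk (Ideal.span {f})) with hP'def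
  have hex : ∃ j : Fin 5, j ≠ 4 ∧ (X j : MvPolynomial (Fin 5) k) ∉ P' := by
    by_contra hall
    push Not at hall
    apply hP
    rw [Ideal.span_le]
    rintro _ ⟨j, rfl⟩
    change X j ∈ P'
    by_cases hj : j = 4
    · subst hj
      have hfP : f ∈ P' := FermatCubicConeChar2.self_mem_comap f P
      have hx : (X 0 : MvPolynomial (Fin 5) k) ∈ P' := hall 0 (by decide)
      have hy : (X 1 : MvPolynomial (Fin 5) k) ∈ P' := hall 1 (by decide)
      have hu : (X 2 : MvPolynomial (Fin 5) k) ∈ P' := hall 2 (by decide)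
      have ht : (X 3 : MvPolynomial (Fin 5) k) ∈ P' := hall 3 (by decide)
      have hz4 : (X 4 : MvPolynomial (Fin 5) k) ^ 4 ∈ P' := by
        have e : (X 4 : MvPolynomial (Fin 5) k) ^ 4 = f - (X 0 ^ 5 * X 4 + X 0 ^ 6 + X 1 ^ 3 + X 2 ^ 3 + X 3 ^ 7) := by rw [hf]; ring
        rw [e]
        refine Ideal.sub_mem _ hfP (Ideal.add_mem _ (Ideal.add_mem _ (Ideal.add_mem _ (Ideal.add_mem _ ?_ ?_) ?_) ?_) ?_)
        · exact Ideal.mul_mem_right _ _ (Ideal.pow_mem_of_mem _ hx 5 (by norm_num))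
        · exact Ideal.pow_mem_of_mem _ hx 6 (by norm_num)
        · exact Ideal.pow_mem_of_mem _ hy 3 (by norm_num)
        · exact Ideal.pow_mem_of_mem _ hu 3 (by norm_num)
        · exact Ideal.pow_mem_of_mem _ ht 7 (by norm_num)
      exact hP'.mem_of_pow_mem 4 hz4
    · exact hall j hj
  obtain ⟨j, hj4, hj⟩ := hex
  by_cases hj0 : j = 0
  · subst hj0
    exact HypersurfaceRegular.stub_hypersurfaceRegularOfPderiv k 5 f 4 P
      (by rw [pderiv_four_f k f hf]; exact fun h => hj (hP'.mem_of_pow_mem 5 h))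
  · by_cases hj3 : j = 3
    · subst hj3
      exact HypersurfaceRegular.stub_hypersurfaceRegularOfPderiv k 5 f 3 P
        (by rw [pderiv_three_f k f hf]; exact fun h => hj (hP'.mem_of_pow_mem 6 h))
    · have hj12 : j = 1 ∨ j = 2 := by
        fin_cases j <;> simp_all
      exact HypersurfaceRegular.stub_hypersurfaceRegularOfPderiv k 5 f j P
        (by rw [pderiv_cube_f k f hf j hj12]; exact fun h => hj (hP'.mem_of_pow_mem 2 h))

/-- `X` is integral. [folklore] -/
theorem isIntegral_fD (k : Type) [Field k] [CharP k 2] (f : MvPolynomial (Fin 5) k)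
    (hf : f = X 4 ^ 4 + X 0 ^ 5 * X 4 + X 0 ^ 6 + X 1 ^ 3 + X 2 ^ 3 + X 3 ^ 7) :
    IsIntegral (Spec (.of (MvPolynomial (Fin 5) k ⧸ Ideal.span {f}))) := by
  haveI := (Ideal.span_singleton_prime (prime_f k f hf).ne_zero).mpr (prime_f k f hf)
  haveI : IsDomain (MvPolynomial (Fin 5) k ⧸ Ideal.span {f}) := Ideal.Quotient.isDomain _
  infer_instance

/-- `(f)` is a prime ideal. [plumbing] -/
theorem isPrime_span_f (k : Type) [Field k] [CharP k 2] (f : MvPolynomial (Fin 5) k)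
    (hf : f = X 4 ^ 4 + X 0 ^ 5 * X 4 + X 0 ^ 6 + X 1 ^ 3 + X 2 ^ 3 + X 3 ^ 7) : (Ideal.span {f}).IsPrime :=
  (Ideal.span_singleton_prime (prime_f k f hf).ne_zero).mpr (prime_f k f hf)

/-- `f ∉ (Xᵢ)` for every `i`: evaluate at a coordinate point with `Xᵢ = 0` where `f = 1` (`e_y`, resp. `e_u` for `i = y`). [folklore] -/
theorem f_not_mem_span_X (k : Type) [Field k] (f : MvPolynomial (Fin 5) k) (hf : f = X 4 ^ 4 + X 0 ^ 5 * X 4 + X 0 ^ 6 + X 1 ^ 3 + X 2 ^ 3 + X 3 ^ 7) :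
    ∀ i : Fin 5, f ∉ Ideal.span {(X i : MvPolynomial (Fin 5) k)} := by
  intro i h
  rw [Ideal.mem_span_singleton] at h
  obtain ⟨c, hc⟩ := h
  by_cases hi : i = 1
  · subst hi
    have := congrArg (MvPolynomial.eval (Pi.single 2 1 : Fin 5 → k)) hc
    rw [hf] at this
    simp at this
  · have := congrArg (MvPolynomial.eval (Pi.single 1 1 : Fin 5 → k)) hc
    rw [hf] at this
    have h1 : (Pi.single 1 1 : Fin 5 → k) i = 0 := by rw [Pi.single_apply, if_neg hi]
    simp [h1] at this

/-- ★ **No variable vanishes in `k[X]/(f)`** (the class rows' binder `hXne`). [plumbing] -/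
theorem mk_X_ne_zero (k : Type) [Field k] [CharP k 2] (f : MvPolynomial (Fin 5) k) (hf : f = X 4 ^ 4 + X 0 ^ 5 * X 4 + X 0 ^ 6 + X 1 ^ 3 + X 2 ^ 3 + X 3 ^ 7) (i : Fin 5) :
    Ideal.Quotient.mk (Ideal.span {f}) (X i) ≠ 0 := fun h0 =>
  PrimeTransfer.X_not_mem_span_of_isPrime (isPrime_span_f k f hf) (f_not_mem_span_X k f hf i) (Ideal.Quotient.eq_zero_iff_mem.mp h0)

/-! ## §2 The binders at the vertex -/

/-- (H1) the vertex is closed. [folklore] -/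
theorem isClosed_vertex (k : Type) [Field k] (f : MvPolynomial (Fin 5) k)
    (hf : f = X 4 ^ 4 + X 0 ^ 5 * X 4 + X 0 ^ 6 + X 1 ^ 3 + X 2 ^ 3 + X 3 ^ 7)
    (v : Spec (.of (MvPolynomial (Fin 5) k ⧸ Ideal.span {f})))
    (hv : v.asIdeal = Ideal.span (Set.range fun j : Fin 5 => Ideal.Quotient.mk (Ideal.span {f}) (X j))) :
    IsClosed ({v} : Set (Spec (.of (MvPolynomial (Fin 5) k ⧸ Ideal.span {f})))) :=
  DoublePointFermatCubicGerm.isClosed_origin k f (constantCoeff_f k f hf) v hv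

/-- (H2) the vertex is NOT regular: `f(0) = 0`, `∇f(0) = 0`. [cite: Hartshorne1977, I Thm. 5.1] -/
theorem vertex_not_mem_regularLocus (k : Type) [Field k] [CharP k 2] (f : MvPolynomial (Fin 5) k)
    (hf : f = X 4 ^ 4 + X 0 ^ 5 * X 4 + X 0 ^ 6 + X 1 ^ 3 + X 2 ^ 3 + X 3 ^ 7)
    (v : Spec (.of (MvPolynomial (Fin 5) k ⧸ Ideal.span {f})))
    (hv : v.asIdeal = Ideal.span (Set.range fun j : Fin 5 => Ideal.Quotient.mk (Ideal.span {f}) (X j))) :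
    v ∉ Scheme.regularLocus (Spec (.of (MvPolynomial (Fin 5) k ⧸ Ideal.span {f}))) := by
  classical
  refine not_mem_regularLocus_Spec_of_not_isRegularLocalRing v ?_
  refine not_isRegularLocalRing_localization_of_pderiv_eval_eq_zero (0 : Fin 5 → k) (prime_f k f hf).ne_zero ?_ ?_ v.asIdeal ?_
  · rw [MvPolynomial.eval_zero]
    exact constantCoeff_f k f hf
  · intro i
    by_cases hi4 : i = 4
    · subst hi4
      rw [pderiv_four_f k f hf, map_pow, MvPolynomial.eval_X, Pi.zero_apply, zero_pow (by norm_num)]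
    by_cases hi0 : i = 0
    · subst hi0
      rw [pderiv_zero_f k f hf, map_mul, map_pow, MvPolynomial.eval_X, Pi.zero_apply, zero_pow (by norm_num), zero_mul]
    by_cases hi3 : i = 3
    · subst hi3
      rw [pderiv_three_f k f hf, map_pow, MvPolynomial.eval_X, Pi.zero_apply, zero_pow (by norm_num)]
    · have hi : i = 1 ∨ i = 2 := by fin_cases i <;> simp_all
      rw [pderiv_cube_f k f hf i hi, map_pow, MvPolynomial.eval_X, Pi.zero_apply, zero_pow two_ne_zero]
  · rw [hv, DoublePointFermatCubicGerm.comap_origin k f (constantCoeff_f k f hf), MvPolynomial.eval_zero, Fedder.span_range_X_eq_ker]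

/-- (H3) `dim 𝒪_{X,v} = 4`. [cite: Matsumura1987, Thm. 13.5] -/
theorem ringKrullDim_stalk_vertex (k : Type) [Field k] [CharP k 2] (f : MvPolynomial (Fin 5) k)
    (hf : f = X 4 ^ 4 + X 0 ^ 5 * X 4 + X 0 ^ 6 + X 1 ^ 3 + X 2 ^ 3 + X 3 ^ 7)
    (v : Spec (.of (MvPolynomial (Fin 5) k ⧸ Ideal.span {f})))
    (hv : v.asIdeal = Ideal.span (Set.range fun j : Fin 5 => Ideal.Quotient.mk (Ideal.span {f}) (X j))) :
    ringKrullDim ((Spec (.of (MvPolynomial (Fin 5) k ⧸ Ideal.span {f}))).presheaf.stalk v) = (4 : ℕ) := by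
  haveI : v.asIdeal.IsMaximal := by
    rw [hv]
    exact DoublePointFermatCubicGerm.isMaximal_origin k f (constantCoeff_f k f hf)
  rw [ringKrullDim_stalk_Spec_eq]
  exact HypersurfaceLocalDim.stub_hypersurfaceLocalDim k 4 f (prime_f k f hf).ne_zero v.asIdeal

/-- `X` is regular at every point other than the vertex. [cite: Hartshorne1977, I Thm. 5.1] -/
theorem regular_of_ne_vertex (k : Type) [Field k] [CharP k 2] (f : MvPolynomial (Fin 5) k)
    (hf : f = X 4 ^ 4 + X 0 ^ 5 * X 4 + X 0 ^ 6 + X 1 ^ 3 + X 2 ^ 3 + X 3 ^ 7)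
    (v : Spec (.of (MvPolynomial (Fin 5) k ⧸ Ideal.span {f})))
    (hv : v.asIdeal = Ideal.span (Set.range fun j : Fin 5 => Ideal.Quotient.mk (Ideal.span {f}) (X j))) :
    ∀ y : Spec (.of (MvPolynomial (Fin 5) k ⧸ Ideal.span {f})), y ⤳ v → y ≠ v →
      y ∈ Scheme.regularLocus (Spec (.of (MvPolynomial (Fin 5) k ⧸ Ideal.span {f}))) := by
  intro y hy hne
  refine FermatCubicConeGerm.mem_regularLocus_Spec_of_isRegularLocalRing y (regular_off_vertex k f hf y.asIdeal fun hle => hne ?_)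
  have h2 : y.asIdeal ≤ v.asIdeal := (PrimeSpectrum.le_iff_specializes y v).mpr hy
  exact PrimeSpectrum.ext (le_antisymm h2 (hv ▸ hle))

/-- (H4) ISOLATED: `Spec 𝒪_{X,v}` is regular off its closed point. [cite: Temkin2008, §2.1] -/
theorem regular_off_closedPoint_vertex (k : Type) [Field k] [CharP k 2] (f : MvPolynomial (Fin 5) k)
    (hf : f = X 4 ^ 4 + X 0 ^ 5 * X 4 + X 0 ^ 6 + X 1 ^ 3 + X 2 ^ 3 + X 3 ^ 7)
    (v : Spec (.of (MvPolynomial (Fin 5) k ⧸ Ideal.span {f})))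
    (hv : v.asIdeal = Ideal.span (Set.range fun j : Fin 5 => Ideal.Quotient.mk (Ideal.span {f}) (X j))) :
    ∀ s : Spec ((Spec (.of (MvPolynomial (Fin 5) k ⧸ Ideal.span {f}))).presheaf.stalk v),
      s ≠ closedPoint _ → s ∈ Scheme.regularLocus (Spec ((Spec (.of (MvPolynomial (Fin 5) k ⧸ Ideal.span {f}))).presheaf.stalk v)) :=
  regularLocus_Spec_stalk_of_isolated v (regular_of_ne_vertex k f hf v hv)

/-- (H5) the CM-clause at every point of `Spec 𝒪_{X,v}`. [cite: Matsumura1987, Thm. 17.4 and Thm. 17.8] -/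
theorem cmCl_Spec_stalk_vertex (k : Type) [Field k] [CharP k 2] (f : MvPolynomial (Fin 5) k)
    (hf : f = X 4 ^ 4 + X 0 ^ 5 * X 4 + X 0 ^ 6 + X 1 ^ 3 + X 2 ^ 3 + X 3 ^ 7)
    (v : Spec (.of (MvPolynomial (Fin 5) k ⧸ Ideal.span {f})))
    (hv : v.asIdeal = Ideal.span (Set.range fun j : Fin 5 => Ideal.Quotient.mk (Ideal.span {f}) (X j))) :
    ∀ s : Spec ((Spec (.of (MvPolynomial (Fin 5) k ⧸ Ideal.span {f}))).presheaf.stalk v),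
      CMCl ((Spec ((Spec (.of (MvPolynomial (Fin 5) k ⧸ Ideal.span {f}))).presheaf.stalk v)).presheaf.stalk s) :=
  cmCl_Spec_stalk_of_isolated v (cmCl_stalk_Spec_of_cmCl_localization v
    (DoublePointFermatCubicGerm.cmCl_localization_hypersurface k f (prime_f k f hf).ne_zero v)) (regular_of_ne_vertex k f hf v hv)

/-! ## §3 The vertex is a BAD point -/

/-- `f ∈ 𝔪^{[2]} = (x², y², u², t², z²)` termwise. [certificate; cite: Fedder1983, Prop. 1.7] -/
theorem f_mem_bracket (k : Type) [Field k] (f : MvPolynomial (Fin 5) k)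
    (hf : f = X 4 ^ 4 + X 0 ^ 5 * X 4 + X 0 ^ 6 + X 1 ^ 3 + X 2 ^ 3 + X 3 ^ 7) :
    f ∈ Ideal.span (Set.range fun i : Fin 5 => (X i : MvPolynomial (Fin 5) k) ^ 2) := by
  have hsq : ∀ j : Fin 5, (X j : MvPolynomial (Fin 5) k) ^ 2 ∈ Ideal.span (Set.range fun i : Fin 5 => (X i : MvPolynomial (Fin 5) k) ^ 2) :=
    fun j => Ideal.subset_span ⟨j, rfl⟩
  rw [hf]
  refine Ideal.add_mem _ (Ideal.add_mem _ (Ideal.add_mem _ (Ideal.add_mem _ (Ideal.add_mem _ ?_ ?_) ?_) ?_) ?_) ?_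
  · rw [show (X 4 : MvPolynomial (Fin 5) k) ^ 4 = X 4 ^ 2 * X 4 ^ 2 by ring]
    exact Ideal.mul_mem_right _ _ (hsq 4)
  · rw [show (X 0 : MvPolynomial (Fin 5) k) ^ 5 * X 4 = X 0 ^ 2 * (X 0 ^ 3 * X 4) by ring]
    exact Ideal.mul_mem_right _ _ (hsq 0)
  · rw [show (X 0 : MvPolynomial (Fin 5) k) ^ 6 = X 0 ^ 2 * X 0 ^ 4 by ring]
    exact Ideal.mul_mem_right _ _ (hsq 0)
  · rw [show (X 1 : MvPolynomial (Fin 5) k) ^ 3 = X 1 ^ 2 * X 1 by ring]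
    exact Ideal.mul_mem_right _ _ (hsq 1)
  · rw [show (X 2 : MvPolynomial (Fin 5) k) ^ 3 = X 2 ^ 2 * X 2 by ring]
    exact Ideal.mul_mem_right _ _ (hsq 2)
  · rw [show (X 3 : MvPolynomial (Fin 5) k) ^ 7 = X 3 ^ 2 * X 3 ^ 5 by ring]
    exact Ideal.mul_mem_right _ _ (hsq 3)

/-- ★ **The vertex of the cusp-edge bed is NOT FULL**: `f ∈ 𝔪^{[2]}` (Fedder necessity at `p = 2`). [cite: Fedder1983, Prop. 1.7] -/
theorem fD_vertex_not_fullCl (k : Type) [Field k] [CharP k 2] (f : MvPolynomial (Fin 5) k)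
    (hf : f = X 4 ^ 4 + X 0 ^ 5 * X 4 + X 0 ^ 6 + X 1 ^ 3 + X 2 ^ 3 + X 3 ^ 7)
    (v : Spec (.of (MvPolynomial (Fin 5) k ⧸ Ideal.span {f})))
    (hv : v.asIdeal = Ideal.span (Set.range fun j : Fin 5 => Ideal.Quotient.mk (Ideal.span {f}) (X j))) :
    ¬ FullCl 2 ((Spec (.of (MvPolynomial (Fin 5) k ⧸ Ideal.span {f}))).presheaf.stalk v) := by
  haveI : Fact (Nat.Prime 2) := ⟨Nat.prime_two⟩
  refine HypersurfaceOriginNotFull.not_fullCl_stalk_origin_of_fedder_mem 2 k f (prime_f k f hf).ne_zero (constantCoeff_f k f hf) ?_ v hv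
  rw [show (2 - 1 : ℕ) = 1 from rfl, pow_one]
  exact f_mem_bracket k f hf

end Summit.ResolutionOfSingularities.ResolutionOfSingularities.Theorems.FInjectiveMacaulayfication.FDSpecimen

end
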